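import Mathlib.LinearAlgebra.Lagrange
import Mathlib.FieldTheory.IsAlgClosed.Basic
import Mathlib.Analysis.Complex.Polynomial.Basic
import HarnessLib

/-!
# The complex-root majority gadget (`stub_majGadget`, line `Sketch`, crux `CircuitNpTc0`)

The step function `j ↦ [m ≤ 2j]` on the nodes `{0, …, m} ⊂ ℂ` is interpolated (Lagrange) by a
polynomial `p` of degree `≤ m`.  Since `ℂ` is algebraically closed, `p` splits:
`p = C p.leadingCoeff * ∏_{r ∈ p.roots} (X - C r)` with `p.roots.card = p.natDegree ≤ m`.
Evaluating at `j ≤ m` gives `p.leadingCoeff * ∏_{r ∈ p.roots} (j - r) = [m ≤ 2j]`, so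
`a := p.leadingCoeff` and `ρ := p.roots.toList` witness the gadget: a majority gate of fan-in `m`
is one product of at most `m` affine forms in `∑ yᵢ` on the cube.
-/

-- `Summit.<Summit>.<Problem>`: for the single-conjunct summit `PneNP` the duplicate `PneNP.PneNP` is mandated (D-0017).
set_option linter.dupNamespace false

namespace Summit.PneNP.PneNP.Cruxes.CircuitNpTc0.Sketch

open Polynomial

/-- **The complex-root majority gadget.** For every `m` there are `a ∈ ℂ` and a list `ρ` of at
most `m` complex numbers with `a · ∏_{r ∈ ρ} (j - r) = [m ≤ 2j]` for all `j ≤ m`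
(Lagrange interpolation of the step on `{0, …, m}` plus `IsAlgClosed ℂ`). [folklore] -/
theorem stub_majGadget (m : ℕ) :
    ∃ (a : ℂ) (ρ : List ℂ), ρ.length ≤ m ∧
      ∀ j : ℕ, j ≤ m → a * (ρ.map fun r => (j : ℂ) - r).prod = if m ≤ 2 * j then 1 else 0 := by
  classical
  -- nodes `0, …, m`, values of the step, and the interpolating polynomial
  set v : ℕ → ℂ := fun i => (i : ℂ) with hv
  set f : ℕ → ℂ := fun i => if m ≤ 2 * i then 1 else 0 with hf
  set p : ℂ[X] := Lagrange.interpolate (Finset.range (m + 1)) v f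
  have hvs : Set.InjOn v (Finset.range (m + 1) : Set ℕ) :=
    fun a _ b _ h => Nat.cast_injective (R := ℂ) h
  have hsplit : p.Splits := IsAlgClosed.splits p
  refine ⟨p.leadingCoeff, p.roots.toList, ?_, ?_⟩
  · -- `ρ.length = p.roots.card = p.natDegree ≤ m`
    rw [Multiset.length_toList, ← hsplit.natDegree_eq_card_roots]
    have hdeg : p.degree ≤ (m : WithBot ℕ) := by
      have h := Lagrange.degree_interpolate_le f hvs
      simpa only [Finset.card_range, Nat.add_sub_cancel] using h
    exact Polynomial.natDegree_le_iff_degree_le.mpr hdeg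
  · intro j hj
    have hjmem : j ∈ Finset.range (m + 1) := Finset.mem_range.mpr (Nat.lt_succ_of_le hj)
    have heval : p.eval (v j) = f j := Lagrange.eval_interpolate_at_node f hvs hjmem
    rw [hsplit.eq_prod_roots, Polynomial.eval_mul, Polynomial.eval_C,
      Polynomial.eval_multiset_prod, Multiset.map_map] at heval
    have hlist : (p.roots.toList.map fun r => (j : ℂ) - r).prod
        = (p.roots.map fun r => Polynomial.eval (v j) (X - C r)).prod := by
      rw [← Multiset.prod_coe, ← Multiset.map_coe, Multiset.coe_toList]
      simp [hv]
    rw [hlist]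
    simpa [hf] using heval

end Summit.PneNP.PneNP.Cruxes.CircuitNpTc0.Sketch
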